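import Summits.AtomisticToContinuum.FouriersLaw.Theorems.CageBudgetFeketeUnboundedHeatVarianceIrOfNoFrozenSiteEnergy
import HarnessLib

/-!
# `CageBudgetFekete.UnboundedHeatVariance`, line Sketch — sequential fibre relaxation ⟹ infrared non-freezing

Support file (`--supports stmt-AtomisticToContinuum-15771`) for the stub
`stub_infraredNonFreezing_of_sequentialFibreRelaxation` (edge "SF") of line `Sketch`.

In the arena of the crux let `S(x,t) = Cov(h₀, h_x ∘ φ_t)` be the energy kernel, `S̄_ν(x) = ν ∫₀^∞ e^{-νt} S(x,t) dt`
its Abel profile, `f̂_ν(k) = Σ_x cos(kx) S̄_ν(x)` the Abel structure factor and `χ(k) = Σ_x cos(kx) S(x,0)` the static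
one. The LANDED fibre calculus (`FibreCalculusSketch.fibreCalculus_proof`) supplies `(1+x²)`-summability of `S(·,0)`
(clause 5, hence continuity of `χ` in `k` by `cosSeries_continuous`) and `χ(0) > 0` (clause 6).

**Sequential deficit.** If along SOME sequence of wavenumbers `k_j → 0` with `cos k_j ≠ 1` the Abel structure factor
can be made arbitrarily small at arbitrarily small `ν` — `∀ j ε ν₁, ∃ ν ∈ (0,ν₁), f̂_ν(k_j) ≤ ε` — then for every `M`
and `ν₁ > 0` there are `k` with `cos k ≠ 1` and `0 < ν < ν₁` with `M (2 - 2 cos k) ≤ χ(k) - f̂_ν(k)`: for `j` large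
`χ(k_j) > 3χ(0)/4` (continuity of `χ` at `0`) and `M (2 - 2 cos k_j) < χ(0)/4` (continuity of `cos`, any sign of
`M`); at such a `j` take `ν ∈ (0,ν₁)` with `f̂_ν(k_j) ≤ χ(0)/2`, so that `χ(k_j) - f̂_ν(k_j) ≥ χ(0)/4 ≥ M (2 - 2cos k_j)`.
-/

noncomputable section

namespace Summit.AtomisticToContinuum.FouriersLaw.Theorems.UnboundedHeatVariance.Sketch

open MeasureTheory Set Filter Topology
open Literature.MathematicalPhysics.KineticTheory.HeatConduction

/-- **Sequential wavenumber deficit** (abstract form). Let `χk` be continuous at `0` with `χk 0 > 0`, let `kseq j → 0`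
with `cos (kseq j) ≠ 1`, and suppose that for every `j`, `ε > 0` and `ν₁ > 0` some `0 < ν < ν₁` has
`fh ν (kseq j) ≤ ε`. Then for every `M` and `ν₁ > 0` there are `k` with `cos k ≠ 1` and `0 < ν < ν₁` with
`M (2 - 2 cos k) ≤ χk k - fh ν k`. [folklore] -/
theorem sequential_wavenumber_deficit (χk : ℝ → ℝ) (fh : ℝ → ℝ → ℝ) (kseq : ℕ → ℝ)
    (hχ : 0 < χk 0) (hχc : ContinuousAt χk 0) (hk0 : Tendsto kseq atTop (𝓝 0))
    (hkc : ∀ j : ℕ, Real.cos (kseq j) ≠ 1)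
    (hkf : ∀ j : ℕ, ∀ ε : ℝ, 0 < ε → ∀ ν₁ : ℝ, 0 < ν₁ → ∃ ν : ℝ, 0 < ν ∧ ν < ν₁ ∧ fh ν (kseq j) ≤ ε)
    (M ν₁ : ℝ) (hν₁ : 0 < ν₁) :
    ∃ k : ℝ, Real.cos k ≠ 1 ∧ ∃ ν : ℝ, 0 < ν ∧ ν < ν₁ ∧ M * (2 - 2 * Real.cos k) ≤ χk k - fh ν k := by
  -- for `j` large, `χk (kseq j) > 3 χk 0 / 4`
  have e1 : ∀ᶠ j in atTop, 3 * χk 0 / 4 < χk (kseq j) :=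
    (hχc.tendsto.comp hk0).eventually (lt_mem_nhds (by linarith))
  -- for `j` large, `M (2 - 2 cos (kseq j)) < χk 0 / 4`
  have hg : Continuous (fun k : ℝ => M * (2 - 2 * Real.cos k)) := by fun_prop
  have ht : Tendsto (fun j : ℕ => M * (2 - 2 * Real.cos (kseq j))) atTop (𝓝 0) := by
    have e := (hg.tendsto 0).comp hk0
    rwa [Real.cos_zero, mul_one, sub_self, mul_zero] at e
  have e2 : ∀ᶠ j in atTop, M * (2 - 2 * Real.cos (kseq j)) < χk 0 / 4 :=
    ht.eventually (gt_mem_nhds (by positivity))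
  obtain ⟨j, hj1, hj2⟩ := (e1.and e2).exists
  obtain ⟨ν, hν, hνν₁, hfν⟩ := hkf j (χk 0 / 2) (by positivity) ν₁ hν₁
  exact ⟨kseq j, hkc j, ν, hν, hνν₁, by linarith⟩

/-- **Stub `stub_infraredNonFreezing_of_sequentialFibreRelaxation`** (edge SF: sequential fibre relaxation ⟹ IR,
of line `Sketch` of `CageBudgetFekete.UnboundedHeatVariance`). In the arena of the crux, with the energy kernel `S`,
its Abel profile `Sb`, the Abel structure factor `fh ν k = Σ_x cos(kx) Sb ν x` and the static one
`χk k = Σ_x cos(kx) S x 0`: if along some sequence `kseq j → 0` with `cos (kseq j) ≠ 1` one has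
`∀ j ε ν₁, ∃ ν ∈ (0,ν₁), fh ν (kseq j) ≤ ε`, then for every `M` and every `ν₁ > 0` some wavenumber `k` with
`cos k ≠ 1` and some `0 < ν < ν₁` have Abel deficit `χk k - fh ν k ≥ M (2 - 2 cos k)` — the sequential wavenumber
deficit over the landed fibre calculus (`FibreCalculusSketch.fibreCalculus_proof`, clauses 5–6: continuity of `χk`
via `cosSeries_continuous`, and `χk 0 > 0`). -/
theorem stub_infraredNonFreezing_of_sequentialFibreRelaxation :
    ∀ ω₂ lam β γ : ℝ, 0 < ω₂ → 0 < lam → 0 < β → ∀ T : ℝ, 0 < T → ∀ μ : MeasureTheory.Measure Literature.MathematicalPhysics.KineticTheory.HeatConduction.ChainConfig, (Literature.MathematicalPhysics.KineticTheory.HeatConduction.pinnedChain ω₂ lam β γ).IsChainGibbsMeasure T μ → Literature.MathematicalPhysics.KineticTheory.HeatConduction.IsShiftInvariant μ → μ.map (fun σ : Literature.MathematicalPhysics.KineticTheory.HeatConduction.ChainConfig => fun x : ℤ => ((σ x).1, -(σ x).2)) = μ → ∀ D : Literature.MathematicalPhysics.KineticTheory.HeatConduction.InfiniteChainDynamics (Literature.MathematicalPhysics.KineticTheory.HeatConduction.pinnedChain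 ω₂ lam β γ), D.PreservesMeasure μ → (∀ t : ℝ, ∀ᵐ σ ∂μ, D.flow t (Literature.MathematicalPhysics.KineticTheory.HeatConduction.shift σ) = Literature.MathematicalPhysics.KineticTheory.HeatConduction.shift (D.flow t σ)) → (∀ t : ℝ, D.HasAbsConvergentCorrelation μ t) → Continuous (fun t : ℝ => D.currentCorrelation μ t) → ∀ h : Literature.MathematicalPhysics.KineticTheory.HeatConduction.ChainConfig → ℤ → ℝ, h = (fun (σ : Literature.MathematicalPhysics.KineticTheory.HeatConduction.ChainConfig) (x : ℤ) => (σ x).2 ^ 2 / 2 + (Literature.MathematicalPhysics.KineticTheory.HeatConduction.pinnedChain ω₂ lam β γ).U (σ x).1 + ((Literature.MathematicalPhysics.KineticTheory.HeatConduction.pinnedChain ω₂ lam β γ).V ((σ (x + 1)).1 - (σ x).1) + (Literature.MathematicalPhysics.KineticTheory.HeatConduction.pinnedChain ω₂ lam β γ).V ((σ x).1 - (σ (x - 1)).1)) / 2) → ∀ S : ℤ → ℝ → ℝ, S = (fun (x : ℤ) (t : ℝ) => ∫ σ, (h σ 0 - ∫ σ', h σ' 0 ∂μ) * (h (D.flow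 t σ) x - ∫ σ', h σ' 0 ∂μ) ∂μ) → ∀ Sb : ℝ → ℤ → ℝ, Sb = (fun (ν : ℝ) (x : ℤ) => ν * ∫ t in Set.Ioi (0:ℝ), Real.exp (-(ν * t)) * S x t) → ∀ fh : ℝ → ℝ → ℝ, fh = (fun (ν k : ℝ) => ∑' x : ℤ, Real.cos (k * (x : ℝ)) * Sb ν x) → ∀ χk : ℝ → ℝ, χk = (fun k : ℝ => ∑' x : ℤ, Real.cos (k * (x : ℝ)) * S x 0) → (∃ kseq : ℕ → ℝ, Filter.Tendsto kseq Filter.atTop (nhds 0) ∧ (∀ j : ℕ, Real.cos (kseq j) ≠ 1) ∧ ∀ j : ℕ, ∀ ε : ℝ, 0 < ε → ∀ ν₁ : ℝ, 0 < ν₁ → ∃ ν : ℝ, 0 < ν ∧ ν < ν₁ ∧ fh ν (kseq j) ≤ ε) → ∀ M ν₁ : ℝ, 0 < ν₁ → ∃ k : ℝ, Real.cos k ≠ 1 ∧ ∃ ν : ℝ, 0 < ν ∧ ν < ν₁ ∧ M * (2 - 2 * Real.cos k) ≤ χk k - fh ν k := by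
  intro ω₂ lam β γ hω hl hβ T hT μ hG hSI hRefl D hP hShift _ _ h hh S hS Sb hSb fh hfh χk hχk hseq M ν₁ hν₁
  obtain ⟨_, _, _, _, h5, h6, _⟩ :=
    Summit.AtomisticToContinuum.FouriersLaw.Theorems.FibreCalculusSketch.fibreCalculus_proof ω₂ lam β γ hω hl hβ T
      hT μ hG hSI hRefl D hP hShift h hh S hS Sb hSb _ rfl _ rfl fh hfh χk hχk
  obtain ⟨kseq, hk0, hkc, hkf⟩ := hseq
  exact sequential_wavenumber_deficit χk fh kseq h6
    (by rw [hχk]; exact (cosSeries_continuous _ h5).continuousAt) hk0 hkc hkf M ν₁ hν₁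

end Summit.AtomisticToContinuum.FouriersLaw.Theorems.UnboundedHeatVariance.Sketch

end
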